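import Summits.Ventures.PercRepro.FaceDecide
import Summits.Ventures.PercRepro.CrossFaces

/-!
# Deciding Lemma B on a list of big faces with one row table: the ten-edge case

A graph with ten edges has twenty-one faces with more than eight free edges: the full face and,
for each edge `e`, the faces with `e` fixed open or fixed closed. `facesCheckList` decides
`score ≥ size` for a list of code faces from ONE packed row table (`withLitB` shares the table
between the faces), `faceSlackZ_nonneg_of_facesCheckList` transports each member to the integer
face slack, `eq_codes_of_one_fixed` identifies a face with exactly one fixed edge with its code
face, and **`faceMap_lemmaB_of_checks_ten`** gives Lemma B on every face of a ten-edge graph from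
the twenty-one checks (the other faces by the 8-point code bound).
-/

namespace PercRepro

open Finset

namespace MultiGraph

section Codes

variable {n k : ℕ}

/-- **The list-of-faces kernel check**: the row table once, then every code face `(U, V)` of the
list has score ≥ size. -/
def facesCheckList (G : MultiGraph (Fin n) (Fin k)) (m : Fin 4 → Fin n) (L : List (ℕ × ℕ)) :
    Bool :=
  withLitB (G.rowTableM m) fun T =>
    decide (∀ q ∈ L, faceSizeM k q.1 q.2 ≤ faceScoreT k T q.1 q.2)

/-- A member of a checked list has nonnegative slack. -/
theorem faceSlackZ_nonneg_of_facesCheckList (G : MultiGraph (Fin n) (Fin k)) (m : Fin 4 → Fin n)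
    {L : List (ℕ × ℕ)} (h : G.facesCheckList m L = true) {U V : ℕ} (hq : (U, V) ∈ L)
    (hU : U < 2 ^ k) (hV : V < 2 ^ k) : 0 ≤ G.faceSlackZ m (cfgOf k U) (cfgOf k V) := by
  unfold facesCheckList at h
  rw [withLitB_eq, decide_eq_true_iff, G.rowTableM_eq] at h
  have hUV := h (U, V) hq
  have := G.faceSlackZ_eq_table m ⟨U, hU⟩ ⟨V, hV⟩
  simp only at this
  rw [this]
  have : (faceSizeM k U V : ℤ) ≤ faceScoreT k (G.rowTable m) U V := by exact_mod_cast hUV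
  linarith

/-- The code `2^e` opens exactly the edge `e`. -/
theorem cfgOf_two_pow (k : ℕ) (e : Fin k) : cfgOf k (2 ^ e.val) = fun x => decide (x = e) := by
  funext x
  simp only [cfgOf, Nat.testBit_two_pow]
  exact decide_eq_decide.mpr ⟨fun h => Fin.ext h.symm, fun h => (congrArg Fin.val h).symm⟩

/-- The code `(2^k − 1) xor 2^e` opens every edge except `e`. -/
theorem cfgOf_two_pow_sub_one_xor (k : ℕ) (e : Fin k) :
    cfgOf k ((2 ^ k - 1) ^^^ 2 ^ e.val) = fun x => decide (x ≠ e) := by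
  funext x
  simp only [cfgOf, Nat.testBit_xor, Nat.testBit_two_pow_sub_one, Nat.testBit_two_pow, x.isLt,
    decide_true, Bool.true_xor]
  cases h : decide (e.val = x.val) <;> simp_all [Fin.ext_iff, eq_comm]

/-- A face with exactly one fixed edge `e₀` is one of the two code faces of `e₀`. -/
theorem eq_codes_of_one_fixed {u v : Config (Fin k)} (hvu : v ≤ u) (e₀ : Fin k)
    (hfree : ∀ e, e ≠ e₀ → v e = false ∧ u e = true) (hnot : ¬ (v e₀ = false ∧ u e₀ = true)) :
    (u = cfgOf k (2 ^ k - 1) ∧ v = cfgOf k (2 ^ e₀.val)) ∨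
      (u = cfgOf k ((2 ^ k - 1) ^^^ 2 ^ e₀.val) ∧ v = cfgOf k 0) := by
  rw [cfgOf_two_pow_sub_one, cfgOf_two_pow, cfgOf_two_pow_sub_one_xor, cfgOf_zero]
  have hle := hvu e₀
  cases hv : v e₀ <;> cases hu : u e₀
  · right
    refine ⟨funext fun x => ?_, funext fun x => ?_⟩
    · by_cases hx : x = e₀
      · subst hx
        simpa using hu
      · simpa [hx] using (hfree x hx).2
    · by_cases hx : x = e₀
      · subst hx
        exact hv
      · exact (hfree x hx).1
  · exact absurd ⟨hv, hu⟩ hnot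
  · rw [hv, hu] at hle
    exact absurd hle Bool.false_lt_true.not_ge
  · left
    refine ⟨funext fun x => ?_, funext fun x => ?_⟩
    · by_cases hx : x = e₀
      · subst hx
        exact hu
      · exact (hfree x hx).2
    · by_cases hx : x = e₀
      · subst hx
        simpa using hv
      · simpa [hx] using (hfree x hx).1

/-- The twenty-one big code faces of a ten-edge graph. -/
def bigFacesTen : List (ℕ × ℕ) :=
  (2 ^ 10 - 1, 0) :: ((List.finRange 10).map fun e : Fin 10 => (2 ^ 10 - 1, 2 ^ e.val)) ++
    ((List.finRange 10).map fun e : Fin 10 => ((2 ^ 10 - 1) ^^^ 2 ^ e.val, 0))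

/-- **Lemma B on every face of a ten-edge graph from the twenty-one checks.** -/
theorem faceMap_lemmaB_of_checks_ten (G : MultiGraph (Fin n) (Fin 10)) (m : Fin 4 → Fin n)
    (h : G.facesCheckList m bigFacesTen = true) (u v : Config (Fin 10)) (hvu : v ≤ u) :
    crossCount cross4 (G.faceMap m u v) ≤ topBotCount (G.faceMap m u v) := by
  by_cases h8 : Fintype.card (Face u v) ≤ 8
  · exact G.faceMap_lemmaB_of_card_le_eight m u v h8
  · have hone := atMostOne_of_card_face_gt (u := u) (v := v) (by simp; omega)
    by_cases hall : ∀ e, v e = false ∧ u e = true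
    · obtain ⟨rfl, rfl⟩ := eq_top_bot_of_free hall
      have h0 := G.faceSlackZ_nonneg_of_facesCheckList m h (U := 2 ^ 10 - 1) (V := 0)
        (by simp [bigFacesTen]) (by norm_num) (by norm_num)
      rw [cfgOf_two_pow_sub_one, cfgOf_zero] at h0
      exact G.faceMap_lemmaB_of_faceSlackZ_nonneg m bot_le h0
    · simp only [not_forall] at hall
      obtain ⟨e₀, hnot'⟩ := hall
      have hfree : ∀ e, e ≠ e₀ → v e = false ∧ u e = true := fun e he =>
        (hone e e₀ he).resolve_right hnot'
      rcases eq_codes_of_one_fixed hvu e₀ hfree hnot' with ⟨rfl, rfl⟩ | ⟨rfl, rfl⟩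
      · have h0 := G.faceSlackZ_nonneg_of_facesCheckList m h (U := 2 ^ 10 - 1)
          (V := 2 ^ e₀.val) (by simp [bigFacesTen]) (by norm_num) (by
            have := e₀.isLt
            calc 2 ^ e₀.val < 2 ^ 10 := Nat.pow_lt_pow_right (by norm_num) this)
        exact G.faceMap_lemmaB_of_faceSlackZ_nonneg m hvu h0
      · have h0 := G.faceSlackZ_nonneg_of_facesCheckList m h (U := (2 ^ 10 - 1) ^^^ 2 ^ e₀.val)
          (V := 0) (by simp [bigFacesTen]) (by
            have := e₀.isLt
            exact Nat.xor_lt_two_pow (by norm_num) (Nat.pow_lt_pow_right (by norm_num) this))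
          (by norm_num)
        exact G.faceMap_lemmaB_of_faceSlackZ_nonneg m hvu h0

end Codes

end MultiGraph

end PercRepro
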